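import Summits.AtomisticToContinuum.FouriersLaw.Theses.TransferKernelPositivity
import Summits.AtomisticToContinuum.FouriersLaw.Theorems.OddSectorIrreversibilityBoundedResponseConvergesSplit
import Summits.AtomisticToContinuum.FouriersLaw.Theorems.TransferKernelPositivityBoundedResponseGlue
import Summits.AtomisticToContinuum.FouriersLaw.Theorems.TransferKernelPositivityTPGlue

/-!
# `TransferKernelPositivity.BoundedResponseConverges` (crux stmt-AtomisticToContinuum-9141) — the exact two-piece
split on route `TransferKernelPositivity`, glue and converse BY NAME

Strategist file (`--supports stmt-AtomisticToContinuum-9141`, crux-strategist seat s2 on route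
`TransferKernelPositivity`). The crux is this route's rank-5 IMPORT SLOT "bounded clause-(ii) response ⇒ `D_N → k > 0`",
shared verbatim with `OddSectorIrreversibility` / `LocalOhmBV` / `MatthiessenLadder` (the four copies are definitionally
equal, `transferKernelPositivity_twin_iff : _ ↔ _ := Iff.rfl` in the crux's `Disproof.lean`). Strategist s1 split the
`OddSectorIrreversibility` copy into the two EXISTING items that are its two printed failure modes —

* `BoundaryEscapeDeficit.EscapeNonOscillation` (stmt-AtomisticToContinuum-12238): the equilibrium escape-deficit sequence
  `N ↦ (N−1)·γ·E_N` has a limit in `EReal` — OSCILLATION EXCLUDED;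
* `JunctionLocality.ConductanceLowerBound` (stmt-AtomisticToContinuum-11749): `D_N ≥ c > 0` eventually — INSULATION
  EXCLUDED —

with the glue `boundedResponseConverges_of_subs` landed (`Theorems/OddSectorIrreversibilityBoundedResponseConvergesSplit.lean`).
This file records the same split for THIS route's copy, so that `ledger route edit route-…-TransferKernelPositivity
--split BoundedResponseConverges --into … --glue-by` can name a landed theorem whose conclusion is LITERALLY
`TransferKernelPositivity.BoundedResponseConverges`:

* `transferKernelPositivity_boundedResponseConverges_of_subs : EscapeNonOscillation → ConductanceLowerBound →
  TransferKernelPositivity.BoundedResponseConverges` (the glue; definitional transport of s1's theorem);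
* EXACTNESS ON THIS ROUTE, modulo the route's OWN cruxes: the bounded-response output of the (proved) bookkeeping item
  `BoundedResponseGlue` (stmt-12014, `boundedResponseGlue_proof`) fed with `LocalOhm` (stmt-12009) and `BVProfile`
  (stmt-12012; itself `TPGlue Passivity MonotoneProfile`, `tpGlue_proof`) and the proved `FiniteResponseProfile_holds` is
  VERBATIM the sibling item `OddSectorIrreversibility.BoundedResponse` (stmt-10924), so the landed converses
  (`escapeNonOscillation_of_boundedResponse_of_boundedResponseConverges`,
  `conductanceLowerBound_of_boundedResponse_of_boundedResponseConverges`) give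
  `LocalOhm → BVProfile → (BoundedResponseConverges ↔ EscapeNonOscillation ∧ ConductanceLowerBound)` and
  `Passivity → MonotoneProfile → LocalOhm → (BoundedResponseConverges ↔ …)`: once this route's own engine has delivered
  bounded response, the import slot is EXACTLY the conjunction of the two children — neither child is the crux reworded
  (each strictly weaker: `boundedResponseConverges_skeleton_oscillating` / `_insulating`, Negative/LoadBearing), and on
  this route nothing is lost by the split.

Pure bookkeeping over landed theorems (definitional unfolding of syntactically identical route decls); no definitions,
no named facts; standard axioms.
-/

noncomputable section

namespace Summit.AtomisticToContinuum.FouriersLaw.Theorems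

open Summit.AtomisticToContinuum.FouriersLaw.Theses

/-- **Split glue on route `TransferKernelPositivity`**: `EscapeNonOscillation` (stmt-12238) and `ConductanceLowerBound`
(stmt-11749) imply this route's copy of the crux `BoundedResponseConverges` (stmt-9141) — s1's
`boundedResponseConverges_of_subs`, transported along the definitional equality of the twins. [folklore] -/
theorem transferKernelPositivity_boundedResponseConverges_of_subs :
    Summit.AtomisticToContinuum.FouriersLaw.Theses.BoundaryEscapeDeficit.EscapeNonOscillation →
      Summit.AtomisticToContinuum.FouriersLaw.Theses.JunctionLocality.ConductanceLowerBound →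
        Summit.AtomisticToContinuum.FouriersLaw.Theses.TransferKernelPositivity.BoundedResponseConverges :=
  boundedResponseConverges_of_subs

/-- The same glue with the floor first. [folklore] -/
theorem transferKernelPositivity_boundedResponseConverges_of_conductanceLowerBound_of_escapeNonOscillation
    (hF : JunctionLocality.ConductanceLowerBound) (hNO : BoundaryEscapeDeficit.EscapeNonOscillation) :
    TransferKernelPositivity.BoundedResponseConverges :=
  transferKernelPositivity_boundedResponseConverges_of_subs hNO hF

/-- **This route's bounded-response output is item 10924.** `BoundedResponseGlue` (stmt-12014, proved) applied to the
route's cruxes `LocalOhm`, `BVProfile` and the proved support `FiniteResponseProfile` yields VERBATIM the statement of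
`OddSectorIrreversibility.BoundedResponse` (stmt-10924). [folklore] -/
theorem transferKernelPositivity_boundedResponse_of_localOhm_of_bvProfile
    (hLO : TransferKernelPositivity.LocalOhm) (hBV : TransferKernelPositivity.BVProfile) :
    OddSectorIrreversibility.BoundedResponse :=
  boundedResponseGlue_proof hLO hBV TransferKernelPositivity.FiniteResponseProfile_holds

/-- The same from the route's two sign cruxes: `Passivity → MonotoneProfile → LocalOhm → BoundedResponse` (stmt-10924),
through the proved `TPGlue` (stmt-12013). [folklore] -/
theorem transferKernelPositivity_boundedResponse_of_passivity_of_monotoneProfile_of_localOhm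
    (hP : TransferKernelPositivity.Passivity) (hM : TransferKernelPositivity.MonotoneProfile)
    (hLO : TransferKernelPositivity.LocalOhm) : OddSectorIrreversibility.BoundedResponse :=
  transferKernelPositivity_boundedResponse_of_localOhm_of_bvProfile hLO (tpGlue_proof hP hM)

/-- **Converse, first half, on this route**: granted `LocalOhm` and `BVProfile`, the crux gives non-oscillation
(stmt-12238). [folklore] -/
theorem transferKernelPositivity_escapeNonOscillation_of_localOhm_of_bvProfile
    (hLO : TransferKernelPositivity.LocalOhm) (hBV : TransferKernelPositivity.BVProfile)
    (hC : TransferKernelPositivity.BoundedResponseConverges) :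
    BoundaryEscapeDeficit.EscapeNonOscillation :=
  escapeNonOscillation_of_boundedResponse_of_boundedResponseConverges
    (transferKernelPositivity_boundedResponse_of_localOhm_of_bvProfile hLO hBV) hC

/-- **Converse, second half, on this route**: granted `LocalOhm` and `BVProfile`, the crux gives the conductance floor
(stmt-11749). [folklore] -/
theorem transferKernelPositivity_conductanceLowerBound_of_localOhm_of_bvProfile
    (hLO : TransferKernelPositivity.LocalOhm) (hBV : TransferKernelPositivity.BVProfile)
    (hC : TransferKernelPositivity.BoundedResponseConverges) :
    JunctionLocality.ConductanceLowerBound :=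
  conductanceLowerBound_of_boundedResponse_of_boundedResponseConverges
    (transferKernelPositivity_boundedResponse_of_localOhm_of_bvProfile hLO hBV) hC

/-- **Exactness of the split on route `TransferKernelPositivity`**: once the route's own engine has delivered its two
bounded-response cruxes `LocalOhm` (stmt-12009) and `BVProfile` (stmt-12012), the import slot `BoundedResponseConverges`
is EQUIVALENT to the conjunction of the two children `EscapeNonOscillation` (stmt-12238) ∧ `ConductanceLowerBound`
(stmt-11749). [folklore] -/
theorem transferKernelPositivity_boundedResponseConverges_iff_subs
    (hLO : TransferKernelPositivity.LocalOhm) (hBV : TransferKernelPositivity.BVProfile) :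
    TransferKernelPositivity.BoundedResponseConverges ↔
      (BoundaryEscapeDeficit.EscapeNonOscillation ∧ JunctionLocality.ConductanceLowerBound) :=
  ⟨fun hC =>
    ⟨transferKernelPositivity_escapeNonOscillation_of_localOhm_of_bvProfile hLO hBV hC,
      transferKernelPositivity_conductanceLowerBound_of_localOhm_of_bvProfile hLO hBV hC⟩,
    fun h => transferKernelPositivity_boundedResponseConverges_of_subs h.1 h.2⟩

/-- The same equivalence stated over the route's sign cruxes `Passivity` (stmt-12010), `MonotoneProfile` (stmt-12008)
and `LocalOhm` (stmt-12009) — i.e. over every OTHER open crux of route `TransferKernelPositivity`: granted them, the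
route's last crux is exactly `EscapeNonOscillation ∧ ConductanceLowerBound`. [folklore] -/
theorem transferKernelPositivity_boundedResponseConverges_iff_subs_of_signCruxes
    (hP : TransferKernelPositivity.Passivity) (hM : TransferKernelPositivity.MonotoneProfile)
    (hLO : TransferKernelPositivity.LocalOhm) :
    TransferKernelPositivity.BoundedResponseConverges ↔
      (BoundaryEscapeDeficit.EscapeNonOscillation ∧ JunctionLocality.ConductanceLowerBound) :=
  transferKernelPositivity_boundedResponseConverges_iff_subs hLO (tpGlue_proof hP hM)

end Summit.AtomisticToContinuum.FouriersLaw.Theorems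

end
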